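import Literature.Barriers.AtomisticToContinuum.DisorderedHarmonicChainDensityUpperMain
import HarnessLib

/-!
# Ajanki–Huveneers 2011, towards the lower bound (5.2) of Prop. 5.1: translation bound for the law of `X_n`

With the integration-by-parts machinery of `…DensityUpperMain.lean` (good part `good_part_bound`,
bad part `bad_part_bound`) we PROVE that the law of the lifted phase `X^x_n` of the critical-band
chain (O. Ajanki, F. Huveneers, CMP **301** (2011) 841–883, arXiv:1003.1076, §3, §5) is almost
translation invariant at small scales, uniformly in the start:
`|𝔼 f(X^x_n) - 𝔼 f(X^x_n - s)| ≤ A_f (C₁|s|/(w√n) + C₁ e^{-c/w}/w)` for continuous `|f| ≤ A_f`,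
`wn ≥ κ`, `w²n ≤ 1` (`translation_bound`). The test function `f - f(· - s)` is the derivative of the
bounded primitive `G(y) = ∫_{y-s}^y f`, `|G| ≤ A_f |s|`, so the (signed) good-part bound applies
verbatim; on the bad event the integrand is at most `2A_f`. This is input (i) of the Fejér-smoothing
proof of the lower bound (5.2) (`…Smoothing.lean`).

[cite: AjankiHuveneers2011, Prop. 5.1 (statement served); folklore (Malliavin-type integration by parts)]
-/

noncomputable section

open Real MeasureTheory Set Filter Function Finset
open scoped ENNReal

namespace Literature.Barriers.AtomisticToContinuum.HeatConduction

variable {τ : ℝ → ℝ} {bm bp : ℝ}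

set_option maxHeartbeats 1600000 in
/-- **Translation bound for the law of `X_n` (towards Prop. 5.1 (5.2))**: for `κ > 0` there are
`C₁, c, w₀ > 0` such that for `0 < w ≤ w₀`, every continuous `f` with `|f| ≤ A_f`, every shift `s`,
every start `x` and every `n` with `wn ≥ κ`, `w²n ≤ 1`:
`|𝔼 f(X_n) - 𝔼 f(X_n - s)| ≤ A_f (C₁|s|/(w√n) + C₁ e^{-c/w}/w)`. Integration by parts along the
disorder with the primitive `G(y) = ∫_{y-s}^y f`, `|G| ≤ A_f |s|` (good part), and the crude bound on
the bad event. [cite: AjankiHuveneers2011, Prop. 5.1 (the statement served); folklore (the route)] -/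
theorem translation_bound (hτ : ReducedLawHyp τ bm bp) (ρB : Measure ℝ) [IsProbabilityMeasure ρB]
    (hρ : ρB = volume.withDensity fun s => ENNReal.ofReal (τ s)) {κ : ℝ} (hκ : 0 < κ) :
    ∃ C₁ c w₀ : ℝ, 0 < C₁ ∧ 0 < c ∧ 0 < w₀ ∧ ∀ w ∈ Set.Ioc 0 w₀,
      ∀ f : ℝ → ℝ, Continuous f → ∀ Af : ℝ, (∀ y, |f y| ≤ Af) → ∀ s x : ℝ, ∀ n : ℕ,
        κ ≤ w * n → w ^ 2 * n ≤ 1 →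
          |∫ B, f (ahPhase w x (finExt B) n) ∂(Measure.pi fun _ : Fin n => ρB) -
              ∫ B, f (ahPhase w x (finExt B) n - s) ∂(Measure.pi fun _ : Fin n => ρB)| ≤
            Af * (C₁ * |s| / (w * Real.sqrt n) + C₁ * Real.exp (-(c / w)) / w) := by
  -- the tilt is zero
  set h : ℝ → ℝ := fun _ => 0 with hhdef
  have hper : Function.Periodic h 1 := fun _ => rfl
  have hh : ContDiff ℝ 1 h := contDiff_const
  -- constants
  set bstar : ℝ := max |bm| |bp| with hbstar
  set R : ℝ := bstar + 1 with hR
  have hbstar0 : 0 ≤ bstar := le_max_of_le_left (abs_nonneg _)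
  have hR0 : 0 < R := by rw [hR]; linarith
  have hhc : Continuous h := hh.continuous
  have hhd : Differentiable ℝ h := hh.differentiable one_ne_zero
  have hhm : Measurable h := hhc.measurable
  have hh'c : Continuous (deriv h) := hh.continuous_deriv le_rfl
  have hper' : Function.Periodic (deriv h) 1 := by
    intro y
    have hfun : (fun z => h (z + 1)) = h := funext hper
    rw [← deriv_comp_add_const, hfun]
  obtain ⟨H, hH0, hH⟩ := exists_bound_of_periodic hhc hper
  obtain ⟨H', hH'0, hH'⟩ := exists_bound_of_periodic hh'c hper'
  set S := smoothingField hτ with hSdef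
  obtain ⟨Ξ, hΞ⟩ := S.ξ_deriv_bound
  have hΞ0 : 0 ≤ Ξ := (abs_nonneg _).trans (hΞ 0)
  obtain ⟨CJ, CΘ, hCJ0, hCΘ0, hmom⟩ := moments_J_Q hτ hρ hhm hH
  obtain ⟨-, Cℓ, hCℓ⟩ := integral_ell_rhoB hτ S hρ
  have hCℓ0 : 0 ≤ Cℓ := le_trans (integral_nonneg fun t => sq_nonneg _) hCℓ
  obtain ⟨Cχ, hCχ0, hCχ⟩ := Literature.Analysis.Calculus.exists_bound_deriv_smoothTransition
  obtain ⟨wt, hwt, ν, hν, ct, hct, htail⟩ := measure_vaN_lt_le hτ S hρ (half_pos hκ)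
  set κ' : ℝ := min (κ / 8) (1 / (10 * π * bstar + 1)) with hκ'
  have hκ'0 : 0 < κ' := by rw [hκ']; exact lt_min (by positivity) (by positivity)
  have hκ'1 : κ' ≤ κ / 8 := min_le_left _ _
  have hκ'small : 10 * π * max |bm| |bp| * κ' ≤ 1 := by
    rw [← hbstar]
    have h1 : κ' ≤ 1 / (10 * π * bstar + 1) := min_le_right _ _
    have h2 : 0 < 10 * π * bstar + 1 := by positivity
    calc 10 * π * bstar * κ' ≤ 10 * π * bstar * (1 / (10 * π * bstar + 1)) :=
          mul_le_mul_of_nonneg_left h1 (by positivity)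
      _ ≤ 1 := by rw [mul_one_div, div_le_one h2]; linarith
  obtain ⟨wc, hwc, Ccr, hCcr0, hcrude⟩ := crude_density_bound_weighted hτ ρB hρ hκ'0 hκ'small
  set CA : ℝ := 2 * bstar * (H + 12 * bstar * H' * κ') with hCA
  have hCA0 : 0 ≤ CA := by rw [hCA]; positivity
  have hlog2 : 0 < Real.log 2 := Real.log_pos one_lt_two
  set w₀ : ℝ := min (min (min (pcW R) wt) (min wc κ')) (min (min (3 * κ / 8) (Real.log 2 / (CA + 1))) 1) with hw₀
  have hw₀0 : 0 < w₀ := by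
    rw [hw₀]
    refine lt_min (lt_min (lt_min (pcW_pos hR0.le) hwt) (lt_min hwc hκ'0)) (lt_min (lt_min (by positivity) ?_) one_pos)
    positivity
  set CM : ℝ := 4 * bstar ^ 2 * CJ * (1 + H' ^ 2) with hCM
  set CL : ℝ := 4 * Cℓ * CJ with hCL
  have hCM0 : 0 ≤ CM := by rw [hCM]; positivity
  have hCL0 : 0 ≤ CL := by rw [hCL]; positivity
  set K₁ : ℝ := (CL + CΘ) / ν + (1 + 4 * π ^ 2) * (CM + CΘ) / ν +
      (CJ + CΘ) / 2 * (4 * H / ν + 16 * (Cχ + 1) * Ξ / ν ^ 2 + 16 * π * (Cχ + 1) / ν ^ 2 +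
        112 * π ^ 3 * bstar ^ 2 / ν + 12 * π / ν) with hK₁
  have hK₁0 : 0 ≤ K₁ := by rw [hK₁]; positivity
  set C₁ : ℝ := K₁ + 4 * Ccr * (CΘ + 1) + 1 with hC₁
  have hC₁0 : 0 < C₁ := by rw [hC₁]; positivity
  refine ⟨C₁, ct * κ / 4, w₀, hC₁0, by positivity, hw₀0, ?_⟩
  -- the claim
  intro w hw f hfc Af hAf s x n hκn hwn
  have hAf0 : 0 ≤ Af := (abs_nonneg _).trans (hAf 0)
  obtain ⟨hw0, hwle⟩ := hw
  have hA : w₀ ≤ min (min (pcW R) wt) (min wc κ') := min_le_left _ _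
  have hB : w₀ ≤ min (min (3 * κ / 8) (Real.log 2 / (CA + 1))) 1 := min_le_right _ _
  have hwR : w ≤ pcW R := hwle.trans (hA.trans ((min_le_left _ _).trans (min_le_left _ _)))
  have hwt' : w ≤ wt := hwle.trans (hA.trans ((min_le_left _ _).trans (min_le_right _ _)))
  have hwc' : w ≤ wc := hwle.trans (hA.trans ((min_le_right _ _).trans (min_le_left _ _)))
  have hwκ' : w ≤ κ' := hwle.trans (hA.trans ((min_le_right _ _).trans (min_le_right _ _)))
  have hw38 : w ≤ 3 * κ / 8 := hwle.trans (hB.trans ((min_le_left _ _).trans (min_le_left _ _)))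
  have hwlog : w ≤ Real.log 2 / (CA + 1) := hwle.trans (hB.trans ((min_le_left _ _).trans (min_le_right _ _)))
  have hw1 : w ≤ 1 := hwle.trans (hB.trans (min_le_right _ _))
  have hwb : w ≤ pcW bstar := hwR.trans (pcW_antitone hbstar0 (by rw [hR]; linarith))
  -- `n ≥ 1`
  have hn1 : 1 ≤ n := by
    by_contra h0
    have : n = 0 := by omega
    subst this
    simp at hκn; linarith
  obtain ⟨n', rfl⟩ : ∃ n', n = n' + 1 := ⟨n - 1, by omega⟩
  set μ := (Measure.pi fun _ : Fin (n' + 1) => ρB) with hμ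
  have hN : ((n' + 1 : ℕ) : ℝ) = n' + 1 := by push_cast; ring
  rw [hN] at hκn hwn
  have hNpos : (0 : ℝ) < n' + 1 := by positivity
  set s_ : ℝ := Real.sqrt (n' + 1) with hs
  have hs0 : 0 < s_ := Real.sqrt_pos.mpr hNpos
  have hss : s_ ^ 2 = n' + 1 := Real.sq_sqrt hNpos.le
  have hs1 : 1 ≤ s_ := by rw [hs]; exact Real.one_le_sqrt.mpr (by linarith [(Nat.cast_nonneg n' : (0:ℝ) ≤ n')])
  have hws : w * s_ ≤ 1 := by
    have h1 : (w * s_) ^ 2 ≤ 1 := by rw [mul_pow, hss]; exact hwn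
    have h2 : 0 ≤ w * s_ := by positivity
    nlinarith
  -- the window
  set Lw : ℕ := ⌈κ' / w⌉₊ with hLw
  have hLw1 : κ' / w ≤ Lw := Nat.le_ceil _
  have hLw2 : (Lw : ℝ) < κ' / w + 1 := Nat.ceil_lt_add_one (by positivity)
  have hwLw1 : κ' ≤ w * Lw := by rw [div_le_iff₀ hw0] at hLw1; linarith
  have hwLw2 : w * Lw ≤ 2 * κ' := by
    have : w * Lw < w * (κ' / w + 1) := mul_lt_mul_of_pos_left hLw2 hw0
    rw [mul_add, mul_div_cancel₀ _ hw0.ne', mul_one] at this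
    linarith
  have hNκ : κ / w ≤ n' + 1 := by rw [div_le_iff₀ hw0]; linarith
  have hLwhalf : (Lw : ℝ) ≤ (n' + 1) / 2 := by
    have h1 : κ' / w + 1 ≤ κ / (2 * w) := by
      rw [div_add_one hw0.ne', div_le_div_iff₀ hw0 (by positivity)]
      nlinarith
    have h2 : κ / (2 * w) ≤ (n' + 1) / 2 := by
      rw [div_le_div_iff₀ (by positivity) (by norm_num : (0:ℝ) < 2)]; nlinarith
    linarith
  have hLwle : Lw ≤ n' + 1 := by
    have : (Lw : ℝ) ≤ n' + 1 := by linarith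
    exact_mod_cast this
  set m₁ : ℕ := n' + 1 - Lw with hm₁def
  have hm₁le : m₁ ≤ n' + 1 := Nat.sub_le _ _
  have hm₁cast : (m₁ : ℝ) = (n' + 1) - Lw := by
    rw [hm₁def, Nat.cast_sub hLwle]; push_cast; ring
  have hm₁2 : (n' + 1 : ℝ) ≤ 2 * m₁ := by rw [hm₁cast]; linarith
  have hm₁0 : 0 < m₁ := by
    have : (0 : ℝ) < m₁ := by linarith
    exact_mod_cast this
  have hwm₁ : κ / 2 ≤ w * m₁ := by
    rw [hm₁cast, mul_sub]; linarith
  have hwin_eq : (n' + 1 - m₁ : ℕ) = Lw := by omega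
  have hwin1 : κ' ≤ w * ((n' + 1 - m₁ : ℕ) : ℝ) := by rw [hwin_eq]; exact hwLw1
  have hwin2 : w * ((n' + 1 - m₁ : ℕ) : ℝ) ≤ 2 * κ' := by rw [hwin_eq]; exact hwLw2
  -- the test function `g₀ = f - f(· - s)` and its primitive `G₀(y) = ∫_{y-s}^y f`
  set P : ℝ → ℝ := fun y => ∫ t in (0:ℝ)..y, f t with hPdef
  have hPd : ∀ y, HasDerivAt P (f y) y := fun y =>
    intervalIntegral.integral_hasDerivAt_right (hfc.intervalIntegrable _ _) (hfc.stronglyMeasurableAtFilter _ _)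
      hfc.continuousAt
  set G₀ : ℝ → ℝ := fun y => P y - P (y - s) with hG₀def
  set g₀ : ℝ → ℝ := fun y => f y - f (y - s) with hg₀
  have hG : ∀ y, HasDerivAt G₀ (g₀ y) y := by
    intro y
    have h2 : HasDerivAt (fun y => P (y - s)) (f (y - s)) y := HasDerivAt.comp_sub_const y s (hPd (y - s))
    exact (hPd y).sub h2
  have hgc : Continuous g₀ := hfc.sub (hfc.comp (continuous_id.sub continuous_const))
  have hAg : ∀ y, |g₀ y| ≤ Af + Af := fun y => by
    simp only [hg₀]
    exact (abs_sub _ _).trans (add_le_add (hAf _) (hAf _))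
  have hAG : ∀ y, |G₀ y| ≤ Af * |s| := by
    intro y
    simp only [hG₀def, hPdef]
    rw [intervalIntegral.integral_interval_sub_left (hfc.intervalIntegrable _ _) (hfc.intervalIntegrable _ _),
      ← Real.norm_eq_abs]
    have := intervalIntegral.norm_integral_le_of_norm_le_const (a := y - s) (b := y) (C := Af) (f := f)
      (fun t _ => by rw [Real.norm_eq_abs]; exact hAf t)
    rwa [show y - (y - s) = s by ring] at this
  -- moments at `(w, n', x)`
  obtain ⟨hJ2, hQ, ⟨hEi, hE1⟩, ⟨hE2i, hE2⟩⟩ := hmom w ⟨hw0, hwb⟩ n' hwn x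
  have hJ2' : ∀ i, i ≤ n' + 1 → ∫ b, vaJ w x (finExt b) i ^ 2 ∂μ ≤ CJ := fun i hi => (hJ2 i hi).2
  obtain ⟨hM2, hM3, hLa⟩ := moments_martingale hτ S hρ hw0 hwR hh hH' hJ2 hCℓ (x := x)
  have h4b : 0 ≤ 4 * bstar ^ 2 * CJ := by positivity
  have hCMge1 : 4 * bstar ^ 2 * CJ ≤ CM :=
    le_mul_of_one_le_right h4b (le_add_of_nonneg_right (sq_nonneg H'))
  have hCMge2 : 4 * bstar ^ 2 * H' ^ 2 * CJ ≤ CM := by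
    have e1 : 4 * bstar ^ 2 * H' ^ 2 * CJ = (4 * bstar ^ 2 * CJ) * H' ^ 2 := by ring
    have e2 : CM = (4 * bstar ^ 2 * CJ) * (1 + H' ^ 2) := by rw [hCM]
    rw [e1, e2]
    exact mul_le_mul_of_nonneg_left (le_add_of_nonneg_left zero_le_one) h4b
  have hN3 : (0 : ℝ) ≤ ((n' : ℝ) + 1) ^ 3 := by positivity
  have hM2' := hM2.trans (mul_le_mul_of_nonneg_right hCMge1 hN3)
  have hM3' := hM3.trans (mul_le_mul_of_nonneg_right hCMge2 hN3)
  have hLa' : ∫ b, (∑ k : Fin (n' + 1), vaA w x (finExt b) k * S.ℓ (b k)) ^ 2 ∂μ ≤ CL * (n' + 1) / w ^ 2 := by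
    rw [hCL]; exact hLa
  -- GOOD part
  have hgood := good_part_bound hτ S hρ hw0 hwR hh hH hG hgc hAg hAG hΞ hm₁le hm₁2 hm₁0 hν hws hCχ0 hCχ
    hCJ0 hCΘ0 hCM0 hCL0 hJ2' hQ hEi hM2' hM3' hLa' (x := x)
  rw [← hbstar] at hgood
  -- BAD part (test function `1`)
  set u : ℝ → ℝ := fun _ => 1 with hudef
  have huc : Continuous u := continuous_const
  have huper : Function.Periodic u 1 := fun _ => rfl
  have hu0 : ∀ y, 0 ≤ u y := fun _ => zero_le_one
  have hEφc : ContinuousOn (fun b : Fin (n' + 1) → ℝ => u (ahPhase w x (finExt b) (n' + 1)) *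
      Real.exp (duT w x h (finExt b) (n' + 1))) (Set.pi Set.univ fun _ : Fin (n' + 1) => Set.Ioo (-R) R) :=
    (huc.comp_continuousOn (continuousOn_ahPhase_pi hR0 hw0.le hwR x (n' + 1))).mul
      (Real.continuous_exp.comp_continuousOn (continuousOn_duT_pi hR0 hw0.le hwR x hhc (n' + 1)))
  have hEφ : Integrable (fun b : Fin (n' + 1) → ℝ => u (ahPhase w x (finExt b) (n' + 1)) *
      Real.exp (duT w x h (finExt b) (n' + 1))) μ := (integrable_pi_of_continuousOn hτ hρ hEφc).2
  have htail' : μ {b | vaN w x (finExt b) S.ξ m₁ < 2 * ν * m₁} ≤ ENNReal.ofReal (Real.exp (-(ct * m₁))) :=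
    htail w ⟨hw0, hwt'⟩ (n' + 1) m₁ hm₁le hwm₁ x
  have hcrude' := hcrude w ⟨hw0, hwc'⟩ (n' + 1) m₁ hm₁le hwin1 hwin2 x
  have hosc : ∀ j : Fin (n' + 1), m₁ ≤ j.val → ∀ b : Fin (n' + 1) → ℝ, (∀ i, bm ≤ b i ∧ b i ≤ bp) →
      ∀ t ∈ Set.Icc bm bp, ∀ t' ∈ Set.Icc bm bp,
        Real.exp (duT w x h (finExt (Function.update b j t)) (n' + 1)) ≤
          2 * Real.exp (duT w x h (finExt (Function.update b j t')) (n' + 1)) := by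
    intro j hj b hb t ht t' ht'
    rw [finExt_update, finExt_update]
    have hB : ∀ i, |finExt b i| ≤ bstar := fun i => abs_finExt_le hb i
    have hjN : (j : ℕ) < n' + 1 := j.isLt
    have hwin : 5 * π * w * bstar * ((n' + 1 - (j : ℕ) : ℕ) : ℝ) ≤ 1 := by
      have h1 : ((n' + 1 - (j : ℕ) : ℕ) : ℝ) ≤ Lw := by exact_mod_cast (show n' + 1 - (j:ℕ) ≤ Lw by omega)
      calc 5 * π * w * bstar * ((n' + 1 - (j : ℕ) : ℕ) : ℝ) ≤ 5 * π * w * bstar * Lw :=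
            mul_le_mul_of_nonneg_left h1 (by positivity)
        _ = 5 * π * bstar * (w * Lw) := by ring
        _ ≤ 5 * π * bstar * (2 * κ') := mul_le_mul_of_nonneg_left hwLw2 (by positivity)
        _ = 10 * π * max |bm| |bp| * κ' := by rw [hbstar]; ring
        _ ≤ 1 := hκ'small
    have hexp := exp_duT_update_le (x := x) hbstar0 hw0 hwb hB hhd hH hH' hjN hwin
      (ReducedLawHyp.abs_le_of_mem ht) (ReducedLawHyp.abs_le_of_mem ht')
    refine hexp.trans (mul_le_mul_of_nonneg_right ?_ (Real.exp_pos _).le)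
    -- the exponent is `≤ C_A w ≤ log 2`
    have h1 : ((n' + 1 - (j : ℕ) : ℕ) : ℝ) ≤ Lw := by exact_mod_cast (show n' + 1 - (j:ℕ) ≤ Lw by omega)
    have hwNj : w * ((n' + 1 - (j : ℕ) : ℕ) : ℝ) ≤ 2 * κ' :=
      (mul_le_mul_of_nonneg_left h1 hw0.le).trans hwLw2
    have hexp_le : 2 * bstar * (w * (H + 6 * w * bstar * H' * ((n' + 1 - (j : ℕ) : ℕ) : ℝ))) ≤ CA * w := by
      rw [hCA]
      have : 6 * w * bstar * H' * ((n' + 1 - (j : ℕ) : ℕ) : ℝ) = 6 * bstar * H' * (w * ((n' + 1 - (j : ℕ) : ℕ) : ℝ)) := by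
        ring
      rw [this]
      have h2 : 6 * bstar * H' * (w * ((n' + 1 - (j : ℕ) : ℕ) : ℝ)) ≤ 6 * bstar * H' * (2 * κ') :=
        mul_le_mul_of_nonneg_left hwNj (by positivity)
      have h2w : 0 ≤ 2 * bstar * w := by positivity
      calc 2 * bstar * (w * (H + 6 * bstar * H' * (w * ((n' + 1 - (j : ℕ) : ℕ) : ℝ))))
          = 2 * bstar * w * H + 2 * bstar * w * (6 * bstar * H' * (w * ((n' + 1 - (j : ℕ) : ℕ) : ℝ))) := by ring
        _ ≤ 2 * bstar * w * H + 2 * bstar * w * (6 * bstar * H' * (2 * κ')) := by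
            have := mul_le_mul_of_nonneg_left h2 h2w; linarith only [this]
        _ = 2 * bstar * (H + 12 * bstar * H' * κ') * w := by ring
    have hCAw : CA * w ≤ Real.log 2 := by
      have h3 : w * (CA + 1) ≤ Real.log 2 := by rwa [le_div_iff₀ (by positivity)] at hwlog
      have h4 : w * (CA + 1) = CA * w + w := by ring
      linarith only [h3, h4, hw0.le]
    calc Real.exp (2 * bstar * (w * (H + 6 * w * bstar * H' * ((n' + 1 - (j : ℕ) : ℕ) : ℝ))))
        ≤ Real.exp (Real.log 2) := Real.exp_le_exp.mpr (hexp_le.trans hCAw)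
      _ = 2 := Real.exp_log two_pos
  have hbad := bad_part_bound S hw0 hhm huc huper hu0 hν hm₁0 hCΘ0 hCcr0 ⟨hE2i, hE2⟩ hEφ htail' hcrude' hosc
    (ρB := ρB) (x := x) (c := ct)
  -- the weight is `1`
  have hE1 : ∀ b : Fin (n' + 1) → ℝ, Real.exp (duT w x h (finExt b) (n' + 1)) = 1 := by
    intro b; simp [duT, hhdef]
  set χv : (Fin (n' + 1) → ℝ) → ℝ := fun b => duChi (ν * m₁) (vaN w x (finExt b) S.ξ m₁) with hχvdef
  set X : (Fin (n' + 1) → ℝ) → ℝ := fun b => ahPhase w x (finExt b) (n' + 1) with hXdef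
  -- continuity ⇒ integrability of the pieces
  set Ucube : Set (Fin (n' + 1) → ℝ) := Set.pi Set.univ fun _ : Fin (n' + 1) => Set.Ioo (-R) R with hUcube
  have hXc : ContinuousOn X Ucube := continuousOn_ahPhase_pi hR0 hw0.le hwR x (n' + 1)
  have hχc : ContinuousOn χv Ucube :=
    (continuous_duChi _).comp_continuousOn (continuousOn_vaN_pi hR0 hw0.le hwR x S.ξ_contDiff.continuous m₁)
  have hI1 : Integrable (fun b => g₀ (X b) * χv b) μ :=
    (integrable_pi_of_continuousOn hτ hρ ((hgc.comp_continuousOn hXc).mul hχc)).2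
  have hI2 : Integrable (fun b => g₀ (X b) * (1 - χv b)) μ :=
    (integrable_pi_of_continuousOn hτ hρ ((hgc.comp_continuousOn hXc).mul (continuousOn_const.sub hχc))).2
  have hIf : Integrable (fun b => f (X b)) μ := (integrable_pi_of_continuousOn hτ hρ (hfc.comp_continuousOn hXc)).2
  have hIfs : Integrable (fun b => f (X b - s)) μ :=
    (integrable_pi_of_continuousOn hτ hρ ((hfc.comp (continuous_id.sub continuous_const)).comp_continuousOn hXc)).2
  -- split: `𝔼 g₀(X) = 𝔼 g₀(X) χ + 𝔼 g₀(X)(1 - χ)`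
  have hsplit : ∫ b, f (X b) ∂μ - ∫ b, f (X b - s) ∂μ = ∫ b, g₀ (X b) * χv b ∂μ + ∫ b, g₀ (X b) * (1 - χv b) ∂μ := by
    rw [← integral_sub hIf hIfs, ← integral_add hI1 hI2]
    refine integral_congr_ae (ae_of_all _ fun b => ?_)
    simp only [hg₀]; ring
  -- GOOD part: `|𝔼 g₀(X) χ| ≤ A_f |s| K₁/(w s_n)`
  have hgood' : |∫ b, g₀ (X b) * χv b ∂μ| ≤ Af * |s| * (K₁ / (w * s_)) := by
    have h1 := hgood
    rw [← hK₁] at h1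
    have e : (fun b => g₀ (ahPhase w x (finExt b) (n' + 1)) * Real.exp (duT w x h (finExt b) (n' + 1)) *
        duChi (ν * ↑m₁) (vaN w x (finExt b) S.ξ m₁)) = fun b => g₀ (X b) * χv b := by
      funext b; rw [hE1 b, mul_one]
    rw [e] at h1
    exact h1
  -- BAD part: `|𝔼 g₀(X)(1-χ)| ≤ 2A_f 𝔼(1-χ) ≤ 2 A_f · 2 C_cr (C_Θ+1) e^{-c m₁/2}/w`
  have hbad1 : ∫ b, u (X b) * Real.exp (duT w x h (finExt b) (n' + 1)) * (1 - χv b) ∂μ ≤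
      2 * Ccr * (CΘ + 1) * (∫ y in Set.Ico (0 : ℝ) 1, u y) * Real.exp (-(ct * m₁ / 2)) / w := hbad
  have hu1 : ∫ y in Set.Ico (0 : ℝ) 1, u y = 1 := by
    simp [hudef]
  rw [hu1, mul_one] at hbad1
  have hbad2 : ∫ b, (1 - χv b) ∂μ ≤ 2 * Ccr * (CΘ + 1) * Real.exp (-(ct * m₁ / 2)) / w := by
    have e : (fun b => u (X b) * Real.exp (duT w x h (finExt b) (n' + 1)) * (1 - χv b)) = fun b => 1 - χv b := by
      funext b; rw [hE1 b]; simp [hudef]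
    rw [e] at hbad1; exact hbad1
  have hχ01 : ∀ b, 0 ≤ 1 - χv b ∧ 1 - χv b ≤ 1 := fun b => by
    have hχ := duChi_mem (ν * m₁) (vaN w x (finExt b) S.ξ m₁)
    simp only [hχvdef]; constructor <;> linarith [hχ.1, hχ.2]
  have hbad' : |∫ b, g₀ (X b) * (1 - χv b) ∂μ| ≤ (Af + Af) * (2 * Ccr * (CΘ + 1) * Real.exp (-(ct * m₁ / 2)) / w) := by
    have hIχ : Integrable (fun b => 1 - χv b) μ :=
      (integrable_pi_of_continuousOn hτ hρ (continuousOn_const.sub hχc)).2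
    calc |∫ b, g₀ (X b) * (1 - χv b) ∂μ| ≤ ∫ b, |g₀ (X b) * (1 - χv b)| ∂μ := abs_integral_le_integral_abs
      _ ≤ ∫ b, (Af + Af) * (1 - χv b) ∂μ := by
          refine integral_mono hI2.abs (hIχ.const_mul _) fun b => ?_
          rw [abs_mul, abs_of_nonneg (hχ01 b).1]
          exact mul_le_mul_of_nonneg_right (hAg _) (hχ01 b).1
      _ = (Af + Af) * ∫ b, (1 - χv b) ∂μ := integral_const_mul _ _
      _ ≤ (Af + Af) * (2 * Ccr * (CΘ + 1) * Real.exp (-(ct * m₁ / 2)) / w) :=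
          mul_le_mul_of_nonneg_left hbad2 (by positivity)
  -- `e^{-c m₁/2} ≤ e^{-cκ/(4w)}`
  have hexp_w : Real.exp (-(ct * m₁ / 2)) ≤ Real.exp (-(ct * κ / 4 / w)) := by
    rw [Real.exp_le_exp, neg_le_neg_iff, div_le_iff₀ hw0]
    have h1 := mul_le_mul_of_nonneg_left hwm₁ hct.le
    have e1 : ct * (κ / 2) = 2 * (ct * κ / 4) := by ring
    have e2 : ct * (w * m₁) = 2 * (ct * m₁ / 2 * w) := by ring
    linarith only [h1, e1, e2]
  -- numerics
  have hws0 : 0 < w * s_ := by positivity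
  have hT1 : Af * |s| * (K₁ / (w * s_)) ≤ Af * (C₁ * |s| / (w * s_)) := by
    rw [show Af * |s| * (K₁ / (w * s_)) = Af * (K₁ * |s| / (w * s_)) by ring]
    refine mul_le_mul_of_nonneg_left (div_le_div_of_nonneg_right ?_ hws0.le) hAf0
    exact mul_le_mul_of_nonneg_right (by rw [hC₁]; linarith [hK₁0, mul_nonneg (mul_nonneg (by norm_num : (0:ℝ) ≤ 4) hCcr0) (add_nonneg hCΘ0 zero_le_one)]) (abs_nonneg _)
  have hT2 : (Af + Af) * (2 * Ccr * (CΘ + 1) * Real.exp (-(ct * m₁ / 2)) / w) ≤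
      Af * (C₁ * Real.exp (-(ct * κ / 4 / w)) / w) := by
    have e : (Af + Af) * (2 * Ccr * (CΘ + 1) * Real.exp (-(ct * m₁ / 2)) / w) =
        Af * ((4 * Ccr * (CΘ + 1)) * Real.exp (-(ct * m₁ / 2)) / w) := by ring
    rw [e]
    refine mul_le_mul_of_nonneg_left (div_le_div_of_nonneg_right ?_ hw0.le) hAf0
    have h4 : 4 * Ccr * (CΘ + 1) ≤ C₁ := by rw [hC₁]; linarith [hK₁0]
    exact mul_le_mul h4 hexp_w (Real.exp_pos _).le hC₁0.le
  have hgoalX : ∫ B, f (ahPhase w x (finExt B) (n' + 1)) ∂μ - ∫ B, f (ahPhase w x (finExt B) (n' + 1) - s) ∂μ =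
      ∫ b, f (X b) ∂μ - ∫ b, f (X b - s) ∂μ := rfl
  rw [hN, hgoalX, hsplit]
  calc |∫ b, g₀ (X b) * χv b ∂μ + ∫ b, g₀ (X b) * (1 - χv b) ∂μ|
      ≤ |∫ b, g₀ (X b) * χv b ∂μ| + |∫ b, g₀ (X b) * (1 - χv b) ∂μ| := abs_add_le _ _
    _ ≤ Af * (C₁ * |s| / (w * s_)) + Af * (C₁ * Real.exp (-(ct * κ / 4 / w)) / w) :=
        add_le_add (hgood'.trans hT1) (hbad'.trans hT2)
    _ = Af * (C₁ * |s| / (w * s_) + C₁ * Real.exp (-(ct * κ / 4 / w)) / w) := by ring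

end Literature.Barriers.AtomisticToContinuum.HeatConduction

end
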